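import Mathlib
import HarnessLib
import Literature.Barriers.CriticalPhenomena.RigorousRGSmallParameterGaussianIntegration
import Literature.Probability.Distributions.GaussianLinearCompensation

/-!
# The one-component field-space Gaussian is Mathlib's multivariate Gaussian
# (bridge `fieldGaussian Λ C 1` ↔ `multivariateGaussian 0 C`)

The tree's Gaussian measure on field space, `LongRangePhi4.fieldGaussian Λ C n` (Slade's `P_C` on
`(ℝⁿ)^Λ`: Mathlib's `N(0, C ⊗ 1ₙ)` on `ℝ^{Λ × n}` transported to `Λ → Fin n → ℝ`), is used by the
gradient-model line with ONE component (`n = 1`), while the Gaussian calculus of quadratic weights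
(`GradientRG.integral_exp_half_quadForm_shift_le`, `GaussianQuadraticMGF.lean`, [ABKM19] (7.8)) is
stated for `multivariateGaussian 0 C` on `EuclideanSpace ℝ Λ`.  This file identifies the two:

* `squeezeMatrix_mul_componentMatrix_mul_transpose` — for the `Λ × (Λ × Fin 1)` matrix `S` of
  `ψ ↦ (x ↦ ψ_{(x,0)})`: `S (C ⊗ 1₁) Sᵀ = C` (no new definitions: `S` is local notation);
* `map_fieldGaussian_one` — the image of `fieldGaussian Λ C 1` under `φ ↦ (x ↦ φ x 0)` is the image
  of `multivariateGaussian 0 C` under `ofLp` (for `C ⪰ 0`);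
* `integral_fieldGaussian_one` — `∫ F(x ↦ φ x 0) dP_C(φ) = ∫ F(ofLp ψ) dN(0,C)(ψ)` for every `F`.

Everything is proved ([ABKM19] (4.3): "`μ_k` is Gaussian with covariance `𝒞_k`" is thereby available
in both encodings).

## References
* S. Adams, S. Buchholz, R. Kotecký, S. Müller, arXiv:1910.13564, Ch. 4 (4.3) and Ch. 7.1 (7.8)
  [AdamsBuchholzKoteckyMuller2019].
* G. Slade, lecture notes (2017), §4.1 (the measure `P_C`) [Slade2017].
-/

noncomputable section

open MeasureTheory ProbabilityTheory Matrix WithLp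
open Literature.Barriers.CriticalPhenomena.LongRangePhi4
open Literature.Probability.Distributions

namespace Literature.MathematicalPhysics.StatisticalMechanics.GradientRG

variable {Λ : Type} [Fintype Λ] [DecidableEq Λ]

/-- The matrix `S_{x,(y,0)} = δ_{xy}` of the coordinate map `ℝ^{Λ × Fin 1} → ℝ^Λ` acts as `ψ ↦ (x ↦ ψ (x, 0))`. [cite: AdamsBuchholzKoteckyMuller2019, Ch. 4 (4.3)] -/
theorem squeezeMatrix_mulVec (ψ : Λ × Fin 1 → ℝ) :
    (Matrix.of fun (x : Λ) (p : Λ × Fin 1) => if p.1 = x then (1 : ℝ) else 0) *ᵥ ψ = fun x => ψ (x, 0) := by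
  funext x
  rw [Matrix.mulVec, dotProduct, ← Finset.univ_product_univ, Finset.sum_product]
  simp only [Matrix.of_apply, Fin.sum_univ_one (fun i => (if _ = x then (1:ℝ) else 0) * ψ (_, i))]
  rw [Finset.sum_eq_single x (fun y _ hy => by rw [if_neg hy, zero_mul])
    (fun h => (h (Finset.mem_univ x)).elim), if_pos rfl, one_mul]

/-- `S (C ⊗ 1₁) Sᵀ = C` for the coordinate matrix `S`. [cite: AdamsBuchholzKoteckyMuller2019, Ch. 4 (4.3)] -/
theorem squeezeMatrix_mul_componentMatrix_mul_transpose (C : Matrix Λ Λ ℝ) :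
    (Matrix.of fun (x : Λ) (p : Λ × Fin 1) => if p.1 = x then (1 : ℝ) else 0) * componentMatrix C 1 * (Matrix.of fun (x : Λ) (p : Λ × Fin 1) => if p.1 = x then (1 : ℝ) else 0)ᵀ = C := by
  ext x y
  rw [Matrix.mul_assoc, Matrix.mul_apply, ← Finset.univ_product_univ, Finset.sum_product]
  simp only [Matrix.of_apply, Fin.sum_univ_one (fun i => (if _ = x then (1:ℝ) else 0) * _)]
  rw [Finset.sum_eq_single x (fun z _ hz => by rw [if_neg hz, zero_mul])
    (fun h => (h (Finset.mem_univ x)).elim), if_pos rfl, one_mul, Matrix.mul_apply,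
    ← Finset.univ_product_univ, Finset.sum_product]
  simp only [Matrix.transpose_apply, Matrix.of_apply, componentMatrix_apply,
    Fin.sum_univ_one (fun i => (if ((0 : Fin 1)) = i then C x _ else 0) * _)]
  rw [Finset.sum_eq_single y (fun z _ hz => by rw [if_neg hz, mul_zero])
    (fun h => (h (Finset.mem_univ y)).elim)]
  simp

omit [Fintype Λ] [DecidableEq Λ] in
/-- The coordinate equivalence `(Λ → Fin 1 → ℝ) ≃ᵐ (Λ → ℝ)` is `φ ↦ (x ↦ φ x 0)`. [cite: AdamsBuchholzKoteckyMuller2019, Ch. 4 (4.3)] -/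
theorem squeezeMEquiv_apply (φ : Λ → Fin 1 → ℝ) :
    (MeasurableEquiv.piCongrRight fun _ : Λ => MeasurableEquiv.funUnique (Fin 1) ℝ) φ = fun x => φ x 0 := rfl

/-- `(x ↦ (fieldEquiv ψ) x 0) = ofLp (matrixCLM (Matrix.of fun (x : Λ) (p : Λ × Fin 1) => if p.1 = x then (1 : ℝ) else 0) ψ)`.
[cite: AdamsBuchholzKoteckyMuller2019, Ch. 4 (4.3)] -/
theorem squeeze_fieldEquiv_eq (ψ : EuclideanSpace ℝ (Λ × Fin 1)) :
    (fun x => fieldEquiv Λ 1 ψ x 0) = ofLp (matrixCLM (Matrix.of fun (x : Λ) (p : Λ × Fin 1) => if p.1 = x then (1 : ℝ) else 0) ψ) := by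
  rw [ofLp_matrixCLM, squeezeMatrix_mulVec]
  rfl

/-- **The one-component field Gaussian is `N(0, C)`**: for `C ⪰ 0`, the image of
`fieldGaussian Λ C 1` under `φ ↦ (x ↦ φ x 0)` is the image of `multivariateGaussian 0 C` under the
coordinate map `ofLp : EuclideanSpace ℝ Λ → (Λ → ℝ)`.
[cite: AdamsBuchholzKoteckyMuller2019, Ch. 4 (4.3)] -/
theorem map_fieldGaussian_one {C : Matrix Λ Λ ℝ} (hC : C.PosSemidef) :
    (fieldGaussian Λ C 1).map (fun φ : Λ → Fin 1 → ℝ => fun x => φ x 0) =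
      (multivariateGaussian (0 : EuclideanSpace ℝ Λ) C).map
        (MeasurableEquiv.toLp 2 (Λ → ℝ)).symm := by
  have hcomp : (fun φ : Λ → Fin 1 → ℝ => fun x => φ x 0) ∘ (fieldEquiv Λ 1) =
      ((MeasurableEquiv.toLp 2 (Λ → ℝ)).symm : EuclideanSpace ℝ Λ → (Λ → ℝ)) ∘
        (matrixCLM (Matrix.of fun (x : Λ) (p : Λ × Fin 1) => if p.1 = x then (1 : ℝ) else 0)) := by
    funext ψ
    simp only [Function.comp_apply, squeeze_fieldEquiv_eq]
    rfl
  have hmeas : Measurable (fun φ : Λ → Fin 1 → ℝ => fun x => φ x 0) :=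
    (MeasurableEquiv.piCongrRight fun _ : Λ => MeasurableEquiv.funUnique (Fin 1) ℝ).measurable
  rw [fieldGaussian, Measure.map_map hmeas (fieldEquiv Λ 1).measurable,
    hcomp, ← Measure.map_map (MeasurableEquiv.toLp 2 (Λ → ℝ)).symm.measurable
      (matrixCLM (Matrix.of fun (x : Λ) (p : Λ × Fin 1) => if p.1 = x then (1 : ℝ) else 0)).continuous.measurable,
    multivariateGaussian_map_matrix (posSemidef_componentMatrix hC)
      (Matrix.of fun (x : Λ) (p : Λ × Fin 1) => if p.1 = x then (1 : ℝ) else 0),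
    squeezeMatrix_mul_componentMatrix_mul_transpose]

/-- **Integrals against the one-component field Gaussian are integrals against `N(0, C)`**:
`∫ F(x ↦ φ x 0) P_C(dφ) = ∫ F(ofLp ψ) N(0,C)(dψ)` for `C ⪰ 0` and every `F`.
[cite: AdamsBuchholzKoteckyMuller2019, Ch. 4 (4.3)] -/
theorem integral_fieldGaussian_one {E : Type*} [NormedAddCommGroup E] [NormedSpace ℝ E]
    {C : Matrix Λ Λ ℝ} (hC : C.PosSemidef) (F : (Λ → ℝ) → E) :
    ∫ φ, F (fun x => φ x 0) ∂(fieldGaussian Λ C 1) =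
      ∫ ψ, F (ofLp ψ) ∂(multivariateGaussian (0 : EuclideanSpace ℝ Λ) C) := by
  have h1 : ∫ φ, F (fun x => φ x 0) ∂(fieldGaussian Λ C 1) =
      ∫ φ, F φ ∂((fieldGaussian Λ C 1).map (fun φ : Λ → Fin 1 → ℝ => fun x => φ x 0)) := by
    rw [show (fun φ : Λ → Fin 1 → ℝ => fun x => φ x 0) =
      ((MeasurableEquiv.piCongrRight fun _ : Λ => MeasurableEquiv.funUnique (Fin 1) ℝ) : (Λ → Fin 1 → ℝ) → (Λ → ℝ)) from rfl,
      integral_map_equiv]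
    rfl
  rw [h1, map_fieldGaussian_one hC, integral_map_equiv]
  rfl

end Literature.MathematicalPhysics.StatisticalMechanics.GradientRG

end
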